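import Summits.BirchSwinnertonDyer.BirchSwinnertonDyer.Theses.EisensteinPrimes
import Summits.BirchSwinnertonDyer.Rank1Residual.EisensteinPrimesSupport
import HarnessLib

/-!
# Crux 3 `MazurMCOnCellB` (stmt-BirchSwinnertonDyer-19033) — PRIME SUPPORT of the crux in the kernel:
# the crux is the conjunction of its four slices at `p = 3, 5, 7, 13` (granted Mazur 1978 + the prime-degree `j`-table)

Width seat bsd-line-x2-p1-w8 (gen 7), cell `bsd-eis`, 2026-08-29; `--supports stmt-BirchSwinnertonDyer-19033 --as helper`.
THEOREMS ONLY (no `def`, no named fact, no `sorry`, no instance). Registered line `twistback` v12 (sha256 `540948e0…`, HELD,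
LEAD g16 verdict «promote-stub FINAL FORM») is NOT touched: this file is bookkeeping on the crux AS A STATEMENT.

WHAT. The crux `MazurMCOnCellB` quantifies over ALL primes `p`:
`∀ W p, X2.CellB W p → X2.MazurMainConjectureAt W p`, where `X2.CellB W p := r_an(W) = 0 ∧ ClassX2 W p ∧ ¬ GVPar W p`
and `ClassX2 W p := p ≠ 2 ∧ Red W p ∧ Mult W p` (`E[p]` reducible, `p` of multiplicative reduction). The tree theorem
`Rank1Residual.EisensteinPrimes.mem_of_classX2` (`Summits/…/Rank1Residual/EisensteinPrimesSupport.lean`, cell `b2b-bsdres`,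
sub-cell `eisenstein-p1`) says that, granted TWO PUBLISHED named facts — Mazur 1978 Thm. 1 (`mazur_isogeny_irreducible`:
a rational `p`-isogeny forces `p ∈ {2, 3, 5, 7, 11, 13, 17, 19, 37, 43, 67, 163}`) and the prime-degree `j`-table
(`primeDegreeIsogeny_jTable`: at `ℓ ∈ {11, 17, 19, 37, 43, 67, 163}` the `j`-invariant is one of the tabulated,
`ℓ`-integral values, hence never multiplicative at `ℓ`) — CLASS X2 LIVES AT `p ∈ {3, 5, 7, 13}`. It had not been
applied to the route's crux decls (rg over `Summits/`: users = `EisensteinPrimesSupport`, `Partition/CornersLargePrime*` only).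
This file does so:

* §1 `eq_or_of_cellB` — an X2b pair has `p = 3 ∨ p = 5 ∨ p = 7 ∨ p = 13`;
  `mazurMainConjectureAt_of_cellB_of_ne` — at every other prime the crux's implication holds OUTRIGHT (vacuously).
* §2 `mazurMCOnCellB_of_slices` / `mazurMCOnCellB_iff_slices` — **`MazurMCOnCellB` ⟺ (slice at 3) ∧ (slice at 5) ∧ (slice at 7)
  ∧ (slice at 13)**, each slice stated with the `Fact (Nat.Prime q)` instance as a binder (so a consumer closes the crux
  by four files, one per prime); `mazurMCOnCellB_iff_forall_mem` — the same with one `p ∈ {3,5,7,13}`-guarded hypothesis;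
  `sliceAt_of_mazurMCOnCellB` — the converse projections (unconditional).
* §3 `mazurMCOnCellB_of_three_of_five_le` — the form matching the cell's bookkeeping: the `p = 3` slice (ladder row A10, the 127
  residue cells + the 2 130 X2b classes of the N9 atlas all sit at `p = 3`) and ONE hypothesis for `5 ≤ p` (where the (Z) class
  atlases of x2-p1-w5/w8 live: 225 + 139 classes at `p = 5`, 10 + 23 at `p = 7`, none tabulated at `p = 13` for `N ≤ 5·10⁵`).

HONEST FRAMING: a STRUCTURAL REDUCTION, conditional on the two PUBLISHED named facts `hMaz`, `hT` (Mazur, Invent. Math. 44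
(1978) Thm. 1; the `j`-table = Mazur's table p. 129 / Cremona *Algorithms* §3.8 p. 82, a registered printed fact awaiting
formal discharge — no `X₀(ℓ)` in the tree). No slice is proved here; no registered stub is closed; no summit statement, no
case of Mazur's main conjecture and no case of BSD is proved by this file; 0 cells / labels / tiers move. The slice at
`p = 13` is genuinely inhabited in general (`X₀(13)` has genus `0`), only empty in Cremona's range (x2-p1-w5 g6 census
07:05:32Z: no `13 ‖ N` among the 258 `13B` classes, `N ≤ 5·10⁵`).

References: [Mazur1978] Thm. 1, Cor. 4.4, table p. 129; [CremonaAlgorithms1997] §3.8 p. 82; [GreenbergVatsal2000] Thm. (1.3)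
(the parity predicate `GVPar`); HOME `run/shared/lean/pub/bsd-eis/` STATUS (LEAD g16 verdict 00:50Z; cstrat g0 STRATEGY-CENSUS).
-/

set_option autoImplicit false
-- `Summit.BirchSwinnertonDyer.BirchSwinnertonDyer.…`: the summit and its single sub-problem share a name.
set_option linter.dupNamespace false

noncomputable section

open WeierstrassCurve Literature.NumberTheory.EllipticCurves Literature.NumberTheory.EllipticCurves.Rank1Residual
  Summit.BirchSwinnertonDyer.Rank1Residual
  Summit.BirchSwinnertonDyer.BirchSwinnertonDyer.Theses

namespace Summit.BirchSwinnertonDyer.BirchSwinnertonDyer.Theorems.EisensteinPrimesMazurMCOnCellBPrimeSupport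

/-! ## §1. The prime support of cell X2b -/

/-- **An X2b pair lives at `p ∈ {3, 5, 7, 13}`** (granted Mazur 1978 Thm. 1 `hMaz` and the prime-degree `j`-table `hT`):
`X2.CellB W p → p = 3 ∨ p = 5 ∨ p = 7 ∨ p = 13`, by `Rank1Residual.EisensteinPrimes.mem_of_classX2` on the `ClassX2`
conjunct of the cell. [cite: Mazur1978, Thm. 1, Cor. 4.4 and table p. 129] [cite: CremonaAlgorithms1997, §3.8 p. 82] -/
theorem eq_or_of_cellB (hMaz : mazur_isogeny_irreducible) (hT : primeDegreeIsogeny_jTable)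
    (W : WeierstrassCurve ℚ) [W.IsElliptic] [W.IsGloballyMinimal] (p : ℕ) [Fact p.Prime]
    (hc : X2.CellB W p) : p = 3 ∨ p = 5 ∨ p = 7 ∨ p = 13 := by
  simpa only [Finset.mem_insert, Finset.mem_singleton] using
    EisensteinPrimes.mem_of_classX2 hMaz hT W p hc.2.1

/-- **Cell X2b is EMPTY at every prime `p ∉ {3, 5, 7, 13}`** (granted `hMaz`, `hT`). [cite: Mazur1978, Thm. 1 and table p. 129]
[cite: CremonaAlgorithms1997, §3.8 p. 82] -/
theorem not_cellB_of_ne (hMaz : mazur_isogeny_irreducible) (hT : primeDegreeIsogeny_jTable)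
    (W : WeierstrassCurve ℚ) [W.IsElliptic] [W.IsGloballyMinimal] (p : ℕ) [Fact p.Prime]
    (h3 : p ≠ 3) (h5 : p ≠ 5) (h7 : p ≠ 7) (h13 : p ≠ 13) : ¬ X2.CellB W p := fun hc => by
  rcases eq_or_of_cellB hMaz hT W p hc with h | h | h | h
  exacts [h3 h, h5 h, h7 h, h13 h]

/-- **The crux's implication holds OUTRIGHT at every prime `p ∉ {3, 5, 7, 13}`** (vacuously: no X2b pair there, granted
`hMaz`, `hT`) — in particular at every `p ≥ 17` and at `p = 2, 11`. [cite: Mazur1978, Thm. 1 and table p. 129]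
[cite: CremonaAlgorithms1997, §3.8 p. 82] -/
theorem mazurMainConjectureAt_of_cellB_of_ne (hMaz : mazur_isogeny_irreducible) (hT : primeDegreeIsogeny_jTable)
    (W : WeierstrassCurve ℚ) [W.IsElliptic] [W.IsGloballyMinimal] (p : ℕ) [Fact p.Prime]
    (h3 : p ≠ 3) (h5 : p ≠ 5) (h7 : p ≠ 7) (h13 : p ≠ 13) (hc : X2.CellB W p) :
    X2.MazurMainConjectureAt W p :=
  absurd hc (not_cellB_of_ne hMaz hT W p h3 h5 h7 h13)

/-- The same above the largest Eisenstein multiplicative prime: **at `p ≥ 14` (so `p ≥ 17`) the crux's implication holds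
outright.** [cite: Mazur1978, Thm. 1 and table p. 129] [cite: CremonaAlgorithms1997, §3.8 p. 82] -/
theorem mazurMainConjectureAt_of_cellB_of_fourteen_le (hMaz : mazur_isogeny_irreducible)
    (hT : primeDegreeIsogeny_jTable) (W : WeierstrassCurve ℚ) [W.IsElliptic] [W.IsGloballyMinimal] (p : ℕ)
    [Fact p.Prime] (hp : 14 ≤ p) (hc : X2.CellB W p) : X2.MazurMainConjectureAt W p :=
  mazurMainConjectureAt_of_cellB_of_ne hMaz hT W p (by omega) (by omega) (by omega) (by omega) hc

/-! ## §2. The crux is the conjunction of its four prime slices -/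

/-- **Projection (unconditional): the crux gives its slice at any fixed prime.** [folklore] -/
theorem sliceAt_of_mazurMCOnCellB (h : EisensteinPrimes.MazurMCOnCellB) (q : ℕ)
    (W : WeierstrassCurve ℚ) [W.IsElliptic] [W.IsGloballyMinimal] [Fact q.Prime] (hc : X2.CellB W q) :
    X2.MazurMainConjectureAt W q :=
  h W q hc

/-- **`MazurMCOnCellB` from its four prime slices** (granted `hMaz`, `hT`): if Mazur's main conjecture holds at every X2b
pair at `p = 3`, at `p = 5`, at `p = 7` and at `p = 13` (each slice quantified over all globally minimal elliptic `W`,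
the `Fact (Nat.Prime q)` instance a binder), then the crux holds — at every other prime cell X2b is empty (§1).
[cite: Mazur1978, Thm. 1 and table p. 129] [cite: CremonaAlgorithms1997, §3.8 p. 82] -/
theorem mazurMCOnCellB_of_slices (hMaz : mazur_isogeny_irreducible) (hT : primeDegreeIsogeny_jTable)
    (h3 : ∀ (W : WeierstrassCurve ℚ) [W.IsElliptic] [W.IsGloballyMinimal] [Fact (Nat.Prime 3)],
      X2.CellB W 3 → X2.MazurMainConjectureAt W 3)
    (h5 : ∀ (W : WeierstrassCurve ℚ) [W.IsElliptic] [W.IsGloballyMinimal] [Fact (Nat.Prime 5)],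
      X2.CellB W 5 → X2.MazurMainConjectureAt W 5)
    (h7 : ∀ (W : WeierstrassCurve ℚ) [W.IsElliptic] [W.IsGloballyMinimal] [Fact (Nat.Prime 7)],
      X2.CellB W 7 → X2.MazurMainConjectureAt W 7)
    (h13 : ∀ (W : WeierstrassCurve ℚ) [W.IsElliptic] [W.IsGloballyMinimal] [Fact (Nat.Prime 13)],
      X2.CellB W 13 → X2.MazurMainConjectureAt W 13) :
    EisensteinPrimes.MazurMCOnCellB := by
  intro W _ _ p _ hc
  rcases eq_or_of_cellB hMaz hT W p hc with rfl | rfl | rfl | rfl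
  exacts [h3 W hc, h5 W hc, h7 W hc, h13 W hc]

/-- **`MazurMCOnCellB` ⟺ the conjunction of its slices at `3, 5, 7, 13`** (granted `hMaz`, `hT`; `⟹` is unconditional).
[cite: Mazur1978, Thm. 1 and table p. 129] [cite: CremonaAlgorithms1997, §3.8 p. 82] -/
theorem mazurMCOnCellB_iff_slices (hMaz : mazur_isogeny_irreducible) (hT : primeDegreeIsogeny_jTable) :
    EisensteinPrimes.MazurMCOnCellB ↔
      ((∀ (W : WeierstrassCurve ℚ) [W.IsElliptic] [W.IsGloballyMinimal] [Fact (Nat.Prime 3)],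
          X2.CellB W 3 → X2.MazurMainConjectureAt W 3) ∧
        (∀ (W : WeierstrassCurve ℚ) [W.IsElliptic] [W.IsGloballyMinimal] [Fact (Nat.Prime 5)],
          X2.CellB W 5 → X2.MazurMainConjectureAt W 5) ∧
        (∀ (W : WeierstrassCurve ℚ) [W.IsElliptic] [W.IsGloballyMinimal] [Fact (Nat.Prime 7)],
          X2.CellB W 7 → X2.MazurMainConjectureAt W 7) ∧
        (∀ (W : WeierstrassCurve ℚ) [W.IsElliptic] [W.IsGloballyMinimal] [Fact (Nat.Prime 13)],
          X2.CellB W 13 → X2.MazurMainConjectureAt W 13)) :=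
  ⟨fun h => ⟨fun W _ _ _ hc => h W 3 hc, fun W _ _ _ hc => h W 5 hc, fun W _ _ _ hc => h W 7 hc,
      fun W _ _ _ hc => h W 13 hc⟩,
    fun h => mazurMCOnCellB_of_slices hMaz hT h.1 h.2.1 h.2.2.1 h.2.2.2⟩

/-- **`MazurMCOnCellB` ⟺ its restriction to `p ∈ {3, 5, 7, 13}`** (one guarded hypothesis; granted `hMaz`, `hT`).
[cite: Mazur1978, Thm. 1 and table p. 129] [cite: CremonaAlgorithms1997, §3.8 p. 82] -/
theorem mazurMCOnCellB_iff_forall_mem (hMaz : mazur_isogeny_irreducible) (hT : primeDegreeIsogeny_jTable) :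
    EisensteinPrimes.MazurMCOnCellB ↔
      ∀ (W : WeierstrassCurve ℚ) [W.IsElliptic] [W.IsGloballyMinimal] (p : ℕ) [Fact p.Prime],
        p ∈ ({3, 5, 7, 13} : Finset ℕ) → X2.CellB W p → X2.MazurMainConjectureAt W p := by
  refine ⟨fun h W _ _ p _ _ hc => h W p hc, fun h W _ _ p _ hc => h W p ?_ hc⟩
  exact EisensteinPrimes.mem_of_classX2 hMaz hT W p hc.2.1

/-! ## §3. The bookkeeping form: the `p = 3` slice (row A10) plus one hypothesis at `p ≥ 5` -/

/-- **`MazurMCOnCellB` from the `p = 3` slice and the `p ≥ 5` slices together** (granted `hMaz`, `hT`): ladder row A10 —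
the 127 residue cells and all 2 130 X2b classes of the N9 atlas — is the `p = 3` slice; the hypothesis `h5` covers
`p = 5, 7, 13` at once (where it is only invoked). `p = 2` never occurs (`ClassX2` demands `p ≠ 2`).
[cite: Mazur1978, Thm. 1 and table p. 129] [cite: CremonaAlgorithms1997, §3.8 p. 82] -/
theorem mazurMCOnCellB_of_three_of_five_le (hMaz : mazur_isogeny_irreducible) (hT : primeDegreeIsogeny_jTable)
    (h3 : ∀ (W : WeierstrassCurve ℚ) [W.IsElliptic] [W.IsGloballyMinimal] [Fact (Nat.Prime 3)],
      X2.CellB W 3 → X2.MazurMainConjectureAt W 3)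
    (h5 : ∀ (W : WeierstrassCurve ℚ) [W.IsElliptic] [W.IsGloballyMinimal] (p : ℕ) [Fact p.Prime],
      5 ≤ p → p ≤ 13 → X2.CellB W p → X2.MazurMainConjectureAt W p) :
    EisensteinPrimes.MazurMCOnCellB := by
  intro W _ _ p _ hc
  rcases eq_or_of_cellB hMaz hT W p hc with rfl | rfl | rfl | rfl
  · exact h3 W hc
  · exact h5 W 5 (by norm_num) (by norm_num) hc
  · exact h5 W 7 (by norm_num) (by norm_num) hc
  · exact h5 W 13 (by norm_num) (by norm_num) hc

/-- **The slices needed are finitely many and bounded: `MazurMCOnCellB` ⟺ its restriction to `3 ≤ p ≤ 13`**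
(granted `hMaz`, `hT`). [cite: Mazur1978, Thm. 1 and table p. 129] [cite: CremonaAlgorithms1997, §3.8 p. 82] -/
theorem mazurMCOnCellB_iff_le_thirteen (hMaz : mazur_isogeny_irreducible) (hT : primeDegreeIsogeny_jTable) :
    EisensteinPrimes.MazurMCOnCellB ↔
      ∀ (W : WeierstrassCurve ℚ) [W.IsElliptic] [W.IsGloballyMinimal] (p : ℕ) [Fact p.Prime],
        p ≤ 13 → X2.CellB W p → X2.MazurMainConjectureAt W p := by
  refine ⟨fun h W _ _ p _ _ hc => h W p hc, fun h W _ _ p _ hc => h W p ?_ hc⟩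
  rcases eq_or_of_cellB hMaz hT W p hc with rfl | rfl | rfl | rfl <;> norm_num

end Summit.BirchSwinnertonDyer.BirchSwinnertonDyer.Theorems.EisensteinPrimesMazurMCOnCellBPrimeSupport

end
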